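import Mathlib
import Literature.Analysis.FluidPDE.NSWave0
import Literature.Analysis.FluidPDE.VectorCalculus

/-!
# Crux `SlicedKelvin.PlanarFluxAPriori` (stmt-NavierStokesRegularity-15600), line `registered`
  (skeleton `Cruxes/PlanarFluxAPriori/Lines/birth.lean`): STUB `stub_initialFluxFinite`

Lands `--supports stmt-NavierStokesRegularity-15600` the registered stub `stub_initialFluxFinite` of
the lead's skeleton: the kinematic `t = 0` anchor. A rapidly decaying field `u₀ : ℝ³ → ℝ³` has
unsigned vorticity flux `∫_{R{x₂ = c}} |curl u₀ · R e₂| dA` through the plane `R{x₂ = c}` bounded by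
a constant `A` independent of the linear isometry `R` and of the height `c`.

Proof: rapid decay with `n = 1`, `K = 3` gives `(1 + ‖x‖)³ ‖Du₀(x)‖ ≤ C`; pointwise
`|curl u₀ (p) · R e₂| ≤ ‖curl u₀ p‖ ≤ 6 ‖Du₀(p)‖ ≤ 6 C (1 + ‖y‖)⁻³` at `p = R (y₀, y₁, c)` since
`‖p‖ = ‖(y₀, y₁, c)‖ ≥ ‖y‖`; the dominating function depends on `y ∈ ℝ²` only and
`∫_{ℝ²} (1 + ‖y‖)⁻³ dy < ∞` (`finite_integral_one_add_norm`, `2 < 3`).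
-/

noncomputable section

namespace Summit.NavierStokesRegularity.NavierStokesRegularity.Theorems.SlicedKelvinPlanarFluxAPriori

set_option linter.dupNamespace false

open MeasureTheory
open Literature.Analysis.FluidPDE

/-- Each entry `Dv(x) eⱼ · eᵢ` of the velocity gradient is bounded by the operator norm `‖Dv(x)‖`. -/
private theorem abs_fderiv_apply_single_le
    (v : EuclideanSpace ℝ (Fin 3) → EuclideanSpace ℝ (Fin 3)) (x : EuclideanSpace ℝ (Fin 3))
    (j i : Fin 3) :
    |fderiv ℝ v x (EuclideanSpace.single j 1) i| ≤ ‖fderiv ℝ v x‖ := by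
  calc |fderiv ℝ v x (EuclideanSpace.single j 1) i|
      = ‖(fderiv ℝ v x (EuclideanSpace.single j 1)) i‖ := (Real.norm_eq_abs _).symm
    _ ≤ ‖fderiv ℝ v x (EuclideanSpace.single j 1)‖ := PiLp.norm_apply_le _ _
    _ ≤ ‖fderiv ℝ v x‖ * ‖EuclideanSpace.single j (1 : ℝ)‖ := ContinuousLinearMap.le_opNorm _ _
    _ = ‖fderiv ℝ v x‖ := by rw [PiLp.norm_single, norm_one, mul_one]

/-- `(a - b)² ≤ (2M)²` when `|a|, |b| ≤ M`. -/
private theorem sq_sub_le_of_abs_le {a b M : ℝ} (ha : |a| ≤ M) (hb : |b| ≤ M) :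
    (a - b) ^ 2 ≤ (2 * M) ^ 2 := by
  have h : |a - b| ≤ 2 * M := (abs_sub a b).trans (by linarith)
  calc (a - b) ^ 2 = |a - b| ^ 2 := (sq_abs _).symm
    _ ≤ (2 * M) ^ 2 := pow_le_pow_left₀ (abs_nonneg _) h 2

/-- Crude pointwise bound of the vorticity by the velocity gradient: `‖curl v x‖ ≤ 6 ‖Dv(x)‖`. -/
private theorem norm_curl_le_fderiv
    (v : EuclideanSpace ℝ (Fin 3) → EuclideanSpace ℝ (Fin 3)) (x : EuclideanSpace ℝ (Fin 3)) :
    ‖curl v x‖ ≤ 6 * ‖fderiv ℝ v x‖ := by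
  have h := abs_fderiv_apply_single_le v x
  have hM : 0 ≤ ‖fderiv ℝ v x‖ := norm_nonneg _
  have h₁ := sq_sub_le_of_abs_le (h 1 2) (h 2 1)
  have h₂ := sq_sub_le_of_abs_le (h 2 0) (h 0 2)
  have h₃ := sq_sub_le_of_abs_le (h 0 1) (h 1 0)
  simp only [curl]
  rw [EuclideanSpace.norm_eq, Real.sqrt_le_left (by positivity)]
  simp only [Fin.sum_univ_three, Real.norm_eq_abs, sq_abs]
  simp
  nlinarith [h₁, h₂, h₃, hM]

/-- The lift `y ↦ (y₀, y₁, c)` of `ℝ²` onto the plane `{x₂ = c}` does not decrease norms. -/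
private theorem norm_le_norm_planeLift (y : EuclideanSpace ℝ (Fin 2)) (c : ℝ) :
    ‖y‖ ≤ ‖(WithLp.toLp 2 ![y 0, y 1, c] : EuclideanSpace ℝ (Fin 3))‖ := by
  rw [EuclideanSpace.norm_eq, EuclideanSpace.norm_eq]
  apply Real.sqrt_le_sqrt
  simp only [Fin.sum_univ_two, Fin.sum_univ_three, Real.norm_eq_abs, sq_abs]
  simp
  nlinarith [sq_nonneg c]

/-- **STUB `stub_initialFluxFinite`** (kinematic `t = 0` anchor of the birth skeleton of
`SlicedKelvin.PlanarFluxAPriori`): a rapidly decaying field `u₀ : ℝ³ → ℝ³` has unsigned vorticity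
flux through the plane `R{x₂ = c}` bounded by a constant `A` independent of the linear isometry `R`
and the height `c`: `∫⁻_{y ∈ ℝ²} ‖curl u₀ (R(y₀, y₁, c)) · R e₂‖ₑ ≤ A`. -/
theorem stub_initialFluxFinite :
    ∀ (u₀ : EuclideanSpace ℝ (Fin 3) → EuclideanSpace ℝ (Fin 3)),
      Literature.Analysis.FluidPDE.HasRapidSpatialDecay u₀ → ∃ A : NNReal, ∀ (R : EuclideanSpace ℝ (Fin 3)
      ≃ₗᵢ[ℝ] EuclideanSpace ℝ (Fin 3)) (c : ℝ), ∫⁻ y : EuclideanSpace ℝ (Fin 2), ‖inner ℝ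
      (Literature.Analysis.FluidPDE.curl u₀ (R (WithLp.toLp 2 ![y 0, y 1, c]))) (R (EuclideanSpace.single 2
      1))‖ₑ ≤ (A : ENNReal) := by
  intro u₀ hu₀
  obtain ⟨C, hC⟩ := hu₀ 1 3
  have hC0 : 0 ≤ C := le_trans (by positivity) (hC 0)
  -- the dominating integral over `ℝ²`, independent of the frame `R` and the height `c`
  have hI : ∫⁻ y : EuclideanSpace ℝ (Fin 2), ENNReal.ofReal ((1 + ‖y‖) ^ (-(3 : ℝ))) < ⊤ :=
    finite_integral_one_add_norm (by rw [finrank_euclideanSpace_fin]; norm_num)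
  refine ⟨(ENNReal.ofReal (6 * C) *
    ∫⁻ y : EuclideanSpace ℝ (Fin 2), ENNReal.ofReal ((1 + ‖y‖) ^ (-(3 : ℝ)))).toNNReal, fun R c => ?_⟩
  rw [ENNReal.coe_toNNReal (ENNReal.mul_ne_top ENNReal.ofReal_ne_top hI.ne),
    ← lintegral_const_mul' _ _ ENNReal.ofReal_ne_top]
  refine lintegral_mono fun y => ?_
  -- pointwise domination at `p = R (y₀, y₁, c)`
  set p : EuclideanSpace ℝ (Fin 3) := R (WithLp.toLp 2 ![y 0, y 1, c]) with hp
  have hyp : ‖y‖ ≤ ‖p‖ := by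
    rw [hp, LinearIsometryEquiv.norm_map]
    exact norm_le_norm_planeLift y c
  have hy0 : 0 < 1 + ‖y‖ := by positivity
  -- decay of the gradient: `‖Du₀(p)‖ ≤ C (1 + ‖y‖)⁻³`
  have hD : ‖fderiv ℝ u₀ p‖ ≤ C * (1 + ‖y‖) ^ (-(3 : ℝ)) := by
    rw [Real.rpow_neg hy0.le, Real.rpow_ofNat, ← div_eq_mul_inv, le_div_iff₀ (by positivity),
      ← norm_iteratedFDeriv_one (𝕜 := ℝ), mul_comm]
    calc (1 + ‖y‖) ^ 3 * ‖iteratedFDeriv ℝ 1 u₀ p‖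
        ≤ (1 + ‖p‖) ^ 3 * ‖iteratedFDeriv ℝ 1 u₀ p‖ := by gcongr
      _ ≤ C := hC p
  -- the flux density is at most `‖curl u₀ p‖ ≤ 6 ‖Du₀(p)‖`
  have hflux : ‖inner ℝ (curl u₀ p) (R (EuclideanSpace.single 2 1))‖ ≤
      6 * C * (1 + ‖y‖) ^ (-(3 : ℝ)) := by
    calc ‖inner ℝ (curl u₀ p) (R (EuclideanSpace.single 2 1))‖
        ≤ ‖curl u₀ p‖ * ‖R (EuclideanSpace.single 2 (1 : ℝ))‖ := norm_inner_le_norm _ _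
      _ = ‖curl u₀ p‖ := by
          rw [LinearIsometryEquiv.norm_map, PiLp.norm_single, norm_one, mul_one]
      _ ≤ 6 * ‖fderiv ℝ u₀ p‖ := norm_curl_le_fderiv u₀ p
      _ ≤ 6 * (C * (1 + ‖y‖) ^ (-(3 : ℝ))) := by gcongr
      _ = 6 * C * (1 + ‖y‖) ^ (-(3 : ℝ)) := by ring
  calc ‖inner ℝ (curl u₀ p) (R (EuclideanSpace.single 2 1))‖ₑ
      = ENNReal.ofReal ‖inner ℝ (curl u₀ p) (R (EuclideanSpace.single 2 1))‖ := (ofReal_norm _).symm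
    _ ≤ ENNReal.ofReal (6 * C * (1 + ‖y‖) ^ (-(3 : ℝ))) := ENNReal.ofReal_le_ofReal hflux
    _ = ENNReal.ofReal (6 * C) * ENNReal.ofReal ((1 + ‖y‖) ^ (-(3 : ℝ))) :=
        ENNReal.ofReal_mul (by positivity)

end Summit.NavierStokesRegularity.NavierStokesRegularity.Theorems.SlicedKelvinPlanarFluxAPriori

end
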